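import Summits.NavierStokesRegularity.FunctionalMining.Candidates
import HarnessLib

/-!
# FunctionalMining — Lemma 0, converse direction: a static rate bound at every datum, with rates at every time, IS the rate budget; and the `ν`-optimisation constant `c_γ`

Search for candidate a priori estimates; no regularity claim. Cell `pub-nsfunc` (host summit
NavierStokesRegularity, topic `FunctionalMining`), census-2 seat (gen 38); kernel companion of the
pen note `pub-nsfunc-census-2/pen/lemma0-B/LEMMA0-CONVERSE-B.md` (second hand on SIEVELD §0
Lemma 0 of the no-go seat, parts (⇐) / assembly).

The tree already has the dynamic ⇒ static direction of Lemma 0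
(`initialRate_le_of_isRateBudget`, `RateBudgets.lean`; `SaturatingLaw.initialRate_le`,
`HeatSieve.lean`): a rate budget `IsRateBudget F B` plus INITIAL rates `HasInitialRate F N V` give
`N u₀ + ν V u₀ ≤ B ν u₀` at every smooth divergence-free zero-mean datum. This file records the
converse, which needs the rates at EVERY time of the window (the budget's predicate demands
differentiability of `s ↦ F (u s)` within `[a, b]` at every `t`, two-sided at interior times —
initial-time rates supply only right derivatives):

* `HasRateEverywhere F N V` — along every zero-mean classical solution on `T³ × [a, b]` and at every
  `t ∈ [a, b]`, `s ↦ F (u s)` has derivative `N (u t) + ν V (u t)` within `[a, b]` at `t`;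
  `HasRateEverywhere.hasInitialRate`;
* `StaticRateBound N V B` — `N u₀ + ν V u₀ ≤ B ν u₀` at every smooth divergence-free zero-mean
  datum and every `ν > 0` (SIEVELD §0, right-hand side of Lemma 0);
* `isRateBudget_of_hasRateEverywhere` — (⇐): `HasRateEverywhere F N V → StaticRateBound N V B →
  IsRateBudget F B` ("apply the static bound at the slice `u t`", which is smooth, divergence-free
  and zero-mean on the closed window);
* `isRateBudget_iff_staticRateBound` — under `HasRateEverywhere`, the budget IS the static bound;
* `saturatingLaw_of_staticRateBound`, `saturatingLaw_iff_staticRateBound` — the same for the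
  dictionary's saturating law `SaturatingLaw F σ γ κ` (`Candidates.lean`), i.e. Lemma 0 of SIEVELD §0
  for functionals with rates at every time (every `C¹`-density core; NOT the one-sided spectral
  cores, whose law is `SaturatingLawSup`);
* `cgamma_mul_rpow_le_rate_family` — the `ν`-optimisation constant of Lemma 0 (ii):
  `(1+γ) γ^{−γ/(1+γ)} D^{γ/(1+γ)} B'^{1/(1+γ)} ≤ ν D + ν^{−γ} B'` for `γ, ν > 0`, `D, B' ≥ 0`
  (weighted AM–GM; `c_γ = (1+γ)γ^{−γ/(1+γ)}`, e.g. `c₃⁴ = 256/27`), and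
  `sub_le_rate_family_of_mul_rpow` — a multiplicative static bound `N ≤ c_γ D^{γ/(1+γ)} B'^{1/(1+γ)}`
  gives the whole family `N − νD ≤ ν^{−γ}B'`, `ν > 0` (Lemma 0 (ii), direction ⇐);
* `mul_rpow_le_of_rate_family` — Lemma 0 (ii), direction ⇒ (optimality of `c_γ`): for `D, B' > 0`
  the family for all `ν > 0` forces `N ≤ c_γ D^{γ/(1+γ)} B'^{1/(1+γ)}` (evaluate at
  `ν* = (γB'/D)^{1/(1+γ)}`); `rate_family_iff_mul_rpow` — both directions; and
  `nonpos_of_rate_family_zero` — the degenerate case `D = 0`: `N ≤ ν^{−γ}B'` for all `ν > 0` forces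
  `N ≤ 0` (a datum with no dissipation rate and positive production kills the family for every
  `κ` — the pen note's proviso P-C);
* `staticRateBound_of_mul_rpow`, `saturatingLaw_of_mul_rpow` — the all-fields multiplicative
  criterion "(C4)": `D₀ ≥ 0` and `N ≤ c_γ D₀^{γ/(1+γ)} (κ (2ℰ) F^{1+1/σ})^{1/(1+γ)}` at every datum,
  for `F ≥ 0`, `κ ≥ 0` with rates `(N, −D₀)` at every time, gives `SaturatingLaw F σ γ κ` — the
  generic form of the step each HOLDS row of the cell's table performs (SIEVELD §3 Theorem G,
  `κ ≥ C / c_γ^{1+γ}`);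
* (filed separately, `SaturatingLawStaticCriterion.lean`) the equivalence form of the all-fields
  criterion (`staticRateBound_iff_mul_rpow`, `saturatingLaw_iff_mul_rpow`) and the sign lemmas.

Not here: the one-sided spectral cores (`SaturatingLawSup`), anything about which functionals
satisfy the criterion, any verdict of the cell's table.

[ours, bookkeeping; SIEVELD §0 Lemma 0 (⇐), (⇒) and (ii)]
-/


noncomputable section

open MeasureTheory Set Filter Topology

namespace Summit.NavierStokesRegularity.FunctionalMining

open Literature.Analysis.FunctionSpaces Literature.Analysis.FluidPDE

variable {d : Type*} [Fintype d] [DecidableEq d]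

/-- **Rates at every time.** `F` has inertial rate `N` and viscous rate `V` at EVERY time: along
every zero-mean classical solution of unforced Navier–Stokes (`ν > 0`) on `T³ × [a, b]`, `a < b`,
and at every `t ∈ [a, b]`, `s ↦ F (u s)` has derivative `N (u t) + ν * V (u t)` within `[a, b]` at
`t` (two-sided at interior times, one-sided at the endpoints). Search for candidate a priori
estimates; no regularity claim — nothing is asserted. [ours, bookkeeping] -/
def HasRateEverywhere (F : (UnitAddTorus d → EuclideanSpace ℝ d) → ℝ)
    (N V : (UnitAddTorus d → EuclideanSpace ℝ d) → ℝ) : Prop :=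
  Fintype.card d = 3 → ∀ ⦃ν : ℝ⦄, 0 < ν → ∀ ⦃a b : ℝ⦄, a < b →
    ∀ ⦃u : ℝ → UnitAddTorus d → EuclideanSpace ℝ d⦄ ⦃p : ℝ → UnitAddTorus d → ℝ⦄,
      Torus.IsClassicalNSSolutionOn (Icc a b) ν 0 u p →
      (∀ t ∈ Icc a b, Torus.HasZeroMean (u t)) →
      ∀ t ∈ Icc a b, HasDerivWithinAt (fun s => F (u s)) (N (u t) + ν * V (u t)) (Icc a b) t

/-- **Static rate bound** (the right-hand side of SIEVELD §0 Lemma 0): `N u₀ + ν V u₀ ≤ B ν u₀` at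
every smooth divergence-free zero-mean datum `u₀` on `T³` and every `ν > 0`. Nothing is asserted.
[ours, bookkeeping] -/
def StaticRateBound (N V : (UnitAddTorus d → EuclideanSpace ℝ d) → ℝ)
    (B : ℝ → (UnitAddTorus d → EuclideanSpace ℝ d) → ℝ) : Prop :=
  ∀ ⦃ν : ℝ⦄, 0 < ν → ∀ ⦃u₀ : UnitAddTorus d → EuclideanSpace ℝ d⦄,
    Torus.IsSmooth u₀ → Torus.IsDivFree u₀ → Torus.HasZeroMean u₀ → N u₀ + ν * V u₀ ≤ B ν u₀

/-- Rates at every time are in particular initial rates. [ours, bookkeeping] -/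
theorem HasRateEverywhere.hasInitialRate {F : (UnitAddTorus d → EuclideanSpace ℝ d) → ℝ}
    {N V : (UnitAddTorus d → EuclideanSpace ℝ d) → ℝ} (h : HasRateEverywhere F N V) :
    HasInitialRate F N V := by
  intro hd ν hν a b hab u p hsol hmean
  exact h hd hν hab hsol hmean a (left_mem_Icc.2 hab.le)

/-- **Lemma 0, (⇐) (kernel form).** Rates at every time and the static rate bound at every datum
give the rate budget: at `t ∈ [a, b]` the derivative within `[a, b]` is `N (u t) + ν V (u t)`
(unique on `Icc`), and the slice `u t` is smooth, divergence-free and zero-mean, so the static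
bound applies there. [ours; SIEVELD §0 Lemma 0 "⇐: apply at u(t)"] -/
theorem isRateBudget_of_hasRateEverywhere {F : (UnitAddTorus d → EuclideanSpace ℝ d) → ℝ}
    {N V : (UnitAddTorus d → EuclideanSpace ℝ d) → ℝ}
    {B : ℝ → (UnitAddTorus d → EuclideanSpace ℝ d) → ℝ}
    (hNV : HasRateEverywhere F N V) (hstat : StaticRateBound N V B) : IsRateBudget F B := by
  intro hd ν hν a b hab u p hsol hmean t ht
  have hder : HasDerivWithinAt (fun s => F (u s)) (N (u t) + ν * V (u t)) (Icc a b) t :=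
    hNV hd hν hab hsol hmean t ht
  refine ⟨hder.differentiableWithinAt, ?_⟩
  rw [hder.derivWithin (uniqueDiffOn_Icc hab t ht)]
  exact hstat hν (hsol.smooth_velocity.isSmooth_slice ht) (hsol.divFree t ht) (hmean t ht)

/-- **Lemma 0 (both directions, kernel form).** For a functional with rates at every time, the
rate budget `IsRateBudget F B` holds iff the static rate bound holds at every datum
(⇒: `initialRate_le_of_isRateBudget`; ⇐: `isRateBudget_of_hasRateEverywhere`). [ours; SIEVELD §0] -/
theorem isRateBudget_iff_staticRateBound {F : (UnitAddTorus d → EuclideanSpace ℝ d) → ℝ}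
    {N V : (UnitAddTorus d → EuclideanSpace ℝ d) → ℝ}
    {B : ℝ → (UnitAddTorus d → EuclideanSpace ℝ d) → ℝ}
    (hNV : HasRateEverywhere F N V) (hd : Fintype.card d = 3) :
    IsRateBudget F B ↔ StaticRateBound N V B :=
  ⟨fun hB _ν hν _u₀ hu₀ hdiv hmean =>
      initialRate_le_of_isRateBudget hB hNV.hasInitialRate hd hν hu₀ hdiv hmean,
    fun h => isRateBudget_of_hasRateEverywhere hNV h⟩

/-- **Lemma 0 (⇐) for the saturating law `T_LD_κ(F; σ, γ)`.** If `F` has rates `(N, V)` at every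
time and `N u₀ + ν V u₀ ≤ κ ν^{−γ} (2ℰ u₀) (F u₀)^{1+1/σ}` at every smooth divergence-free zero-mean
datum and every `ν > 0`, then `SaturatingLaw F σ γ κ`. [ours; SIEVELD §0 Lemma 0] -/
theorem saturatingLaw_of_staticRateBound {F : (UnitAddTorus d → EuclideanSpace ℝ d) → ℝ}
    {N V : (UnitAddTorus d → EuclideanSpace ℝ d) → ℝ} {σ γ κ : ℝ}
    (hNV : HasRateEverywhere F N V)
    (hstat : StaticRateBound N V
      (fun ν v => κ * ν ^ (-γ) * (2 * torusEnstrophy v) * F v ^ (1 + σ⁻¹))) :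
    SaturatingLaw (d := d) F σ γ κ :=
  isRateBudget_of_hasRateEverywhere hNV hstat

/-- **Lemma 0 for the saturating law, both directions.** For a functional with rates at every
time, `SaturatingLaw F σ γ κ` iff the static inequality
`N u₀ + ν V u₀ ≤ κ ν^{−γ} (2ℰ u₀) (F u₀)^{1+1/σ}` holds at every smooth divergence-free zero-mean datum
and every `ν > 0`. [ours; SIEVELD §0 Lemma 0] -/
theorem saturatingLaw_iff_staticRateBound {F : (UnitAddTorus d → EuclideanSpace ℝ d) → ℝ}
    {N V : (UnitAddTorus d → EuclideanSpace ℝ d) → ℝ} {σ γ κ : ℝ}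
    (hNV : HasRateEverywhere F N V) (hd : Fintype.card d = 3) :
    SaturatingLaw (d := d) F σ γ κ ↔
      StaticRateBound N V (fun ν v => κ * ν ^ (-γ) * (2 * torusEnstrophy v) * F v ^ (1 + σ⁻¹)) :=
  isRateBudget_iff_staticRateBound hNV hd


/-! ## Lemma 0 (ii), the direction the HOLDS rows use: a multiplicative static bound gives the whole `ν`-family (weighted AM–GM) -/

/-- **The `ν`-optimisation constant `c_γ = (1+γ) γ^{−γ/(1+γ)}` is what weighted AM–GM gives.** For
`γ > 0`, `ν > 0`, `D ≥ 0`, `B' ≥ 0`: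
`(1+γ) γ^{−γ/(1+γ)} · D^{γ/(1+γ)} · B'^{1/(1+γ)} ≤ ν D + ν^{−γ} B'`
(weights `γ/(1+γ)`, `1/(1+γ)` on `(1+γ)νD/γ` and `(1+γ)ν^{−γ}B'`; equality at
`ν* = (γB'/D)^{1/(1+γ)}`). [ours; SIEVELD §0 Lemma 0 (ii), `c_γ`; Mathlib
`Real.geom_mean_le_arith_mean2_weighted`] -/
theorem cgamma_mul_rpow_le_rate_family {γ ν D B' : ℝ} (hγ : 0 < γ) (hν : 0 < ν) (hD : 0 ≤ D)
    (hB' : 0 ≤ B') :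
    (1 + γ) * γ ^ (-(γ / (1 + γ))) * (D ^ (γ / (1 + γ)) * B' ^ (1 / (1 + γ))) ≤
      ν * D + ν ^ (-γ) * B' := by
  have h1γ : 0 < 1 + γ := by linarith
  set w₁ : ℝ := γ / (1 + γ) with hw₁_def
  set w₂ : ℝ := 1 / (1 + γ) with hw₂_def
  have hw₁ : 0 < w₁ := div_pos hγ h1γ
  have hw₂ : 0 < w₂ := div_pos one_pos h1γ
  have hw : w₁ + w₂ = 1 := by
    rw [hw₁_def, hw₂_def, ← add_div, div_eq_one_iff_eq h1γ.ne']; ring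
  have hνγ : 0 < ν ^ (-γ) := Real.rpow_pos_of_pos hν _
  have hp₁ : 0 ≤ (1 + γ) / γ * (ν * D) := by positivity
  have hp₂ : 0 ≤ (1 + γ) * (ν ^ (-γ) * B') := by positivity
  have hAM := Real.geom_mean_le_arith_mean2_weighted hw₁.le hw₂.le hp₁ hp₂ hw
  -- the arithmetic side is `ν D + ν^{−γ} B'`
  have hR : w₁ * ((1 + γ) / γ * (ν * D)) + w₂ * ((1 + γ) * (ν ^ (-γ) * B')) =
      ν * D + ν ^ (-γ) * B' := by
    rw [hw₁_def, hw₂_def]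
    field_simp
  -- the geometric side is `c_γ D^{w₁} B'^{w₂}`
  have hνpow : ν ^ w₁ * ν ^ (-γ * w₂) = 1 := by
    rw [← Real.rpow_add hν]
    have h0 : w₁ + -γ * w₂ = 0 := by
      rw [hw₁_def, hw₂_def]
      field_simp
      ring
    rw [h0, Real.rpow_zero]
  have h1pow : (1 + γ) ^ w₁ * (1 + γ) ^ w₂ = 1 + γ := by
    rw [← Real.rpow_add h1γ, hw, Real.rpow_one]
  have hL : ((1 + γ) / γ * (ν * D)) ^ w₁ * ((1 + γ) * (ν ^ (-γ) * B')) ^ w₂ =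
      (1 + γ) * γ ^ (-w₁) * (D ^ w₁ * B' ^ w₂) := by
    rw [Real.mul_rpow (by positivity) (by positivity), Real.mul_rpow hν.le hD,
      Real.div_rpow h1γ.le hγ.le, Real.mul_rpow h1γ.le (by positivity),
      Real.mul_rpow hνγ.le hB', ← Real.rpow_mul hν.le, Real.rpow_neg hγ.le]
    calc (1 + γ) ^ w₁ / γ ^ w₁ * (ν ^ w₁ * D ^ w₁) *
          ((1 + γ) ^ w₂ * (ν ^ (-γ * w₂) * B' ^ w₂))
        = ((1 + γ) ^ w₁ * (1 + γ) ^ w₂) * (γ ^ w₁)⁻¹ * (ν ^ w₁ * ν ^ (-γ * w₂)) *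
            (D ^ w₁ * B' ^ w₂) := by ring
      _ = (1 + γ) * (γ ^ w₁)⁻¹ * (D ^ w₁ * B' ^ w₂) := by rw [h1pow, hνpow]; ring
  calc (1 + γ) * γ ^ (-w₁) * (D ^ w₁ * B' ^ w₂)
      = ((1 + γ) / γ * (ν * D)) ^ w₁ * ((1 + γ) * (ν ^ (-γ) * B')) ^ w₂ := hL.symm
    _ ≤ w₁ * ((1 + γ) / γ * (ν * D)) + w₂ * ((1 + γ) * (ν ^ (-γ) * B')) := hAM
    _ = ν * D + ν ^ (-γ) * B' := hR

/-- **Lemma 0 (ii), ⇐.** A multiplicative static bound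
`N ≤ c_γ · D^{γ/(1+γ)} · B'^{1/(1+γ)}` with `D ≥ 0`, `B' ≥ 0` gives the whole family
`N − ν D ≤ ν^{−γ} B'` for every `ν > 0`. [ours; SIEVELD §0 Lemma 0 (ii)] -/
theorem sub_le_rate_family_of_mul_rpow {γ ν N D B' : ℝ} (hγ : 0 < γ) (hν : 0 < ν) (hD : 0 ≤ D)
    (hB' : 0 ≤ B')
    (hN : N ≤ (1 + γ) * γ ^ (-(γ / (1 + γ))) * (D ^ (γ / (1 + γ)) * B' ^ (1 / (1 + γ)))) :
    N - ν * D ≤ ν ^ (-γ) * B' := by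
  have := cgamma_mul_rpow_le_rate_family hγ hν hD hB'
  linarith

/-- **Lemma 0 (ii), ⇒ (optimality of `c_γ`).** If `D > 0`, `B' > 0`, `γ > 0` and the whole family
`N − ν D ≤ ν^{−γ} B'` holds for every `ν > 0`, then `N ≤ c_γ · D^{γ/(1+γ)} · B'^{1/(1+γ)}`:
evaluate the family at the optimal viscosity `ν* = (γ B'/D)^{1/(1+γ)}`, where
`ν* D = γ^{1/(1+γ)} D^{γ/(1+γ)} B'^{1/(1+γ)}`, `ν*^{−γ} B' = γ^{−γ/(1+γ)} D^{γ/(1+γ)} B'^{1/(1+γ)}` and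
`γ^{1/(1+γ)} + γ^{−γ/(1+γ)} = (1+γ) γ^{−γ/(1+γ)} = c_γ`. [ours; SIEVELD §0 Lemma 0 (ii), `ν*`] -/
theorem mul_rpow_le_of_rate_family {γ N D B' : ℝ} (hγ : 0 < γ) (hD : 0 < D) (hB' : 0 < B')
    (h : ∀ ν : ℝ, 0 < ν → N - ν * D ≤ ν ^ (-γ) * B') :
    N ≤ (1 + γ) * γ ^ (-(γ / (1 + γ))) * (D ^ (γ / (1 + γ)) * B' ^ (1 / (1 + γ))) := by
  have h1γ : 0 < 1 + γ := by linarith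
  set w₁ : ℝ := γ / (1 + γ) with hw₁_def
  set w₂ : ℝ := 1 / (1 + γ) with hw₂_def
  have hw : w₁ + w₂ = 1 := by
    rw [hw₁_def, hw₂_def, ← add_div, div_eq_one_iff_eq h1γ.ne']; ring
  have hq : 0 < γ * B' / D := by positivity
  -- the optimal viscosity `ν* = (γ B' / D)^{1/(1+γ)}`
  obtain ⟨ν, hν_def⟩ : ∃ ν : ℝ, ν = (γ * B' / D) ^ w₂ := ⟨_, rfl⟩
  have hν : 0 < ν := by rw [hν_def]; exact Real.rpow_pos_of_pos hq _
  have key := h ν hν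
  have hDw₁ : D ^ w₁ = D / D ^ w₂ := by
    rw [show w₁ = 1 - w₂ by linarith [hw], Real.rpow_sub hD, Real.rpow_one]
  have hB'w₂ : B' ^ w₂ = B' / B' ^ w₁ := by
    rw [show w₂ = 1 - w₁ by linarith [hw], Real.rpow_sub hB', Real.rpow_one]
  have hγw₁ : 0 < γ ^ w₁ := Real.rpow_pos_of_pos hγ _
  have hB'w₁ : 0 < B' ^ w₁ := Real.rpow_pos_of_pos hB' _
  have hDw₂ : 0 < D ^ w₂ := Real.rpow_pos_of_pos hD _
  have hDw₁' : 0 < D ^ w₁ := Real.rpow_pos_of_pos hD _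
  -- `ν* D = γ^{w₂} D^{w₁} B'^{w₂}`
  have hνD : ν * D = γ ^ w₂ * (D ^ w₁ * B' ^ w₂) := by
    rw [hν_def, Real.div_rpow (by positivity) hD.le, Real.mul_rpow hγ.le hB'.le, hDw₁]
    field_simp
  -- `ν*^{−γ} B' = γ^{−w₁} D^{w₁} B'^{w₂}`
  have hexp : w₂ * -γ = -w₁ := by rw [hw₁_def, hw₂_def]; ring
  have hνγ : ν ^ (-γ) * B' = γ ^ (-w₁) * (D ^ w₁ * B' ^ w₂) := by
    rw [hν_def, ← Real.rpow_mul hq.le, hexp, Real.rpow_neg hq.le, Real.div_rpow (by positivity) hD.le,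
      Real.mul_rpow hγ.le hB'.le, Real.rpow_neg hγ.le, hB'w₂]
    field_simp
  -- `γ^{w₂} + γ^{−w₁} = (1+γ) γ^{−w₁}`
  have hsum : γ ^ w₂ + γ ^ (-w₁) = (1 + γ) * γ ^ (-w₁) := by
    have hγsplit : γ ^ w₂ * γ ^ w₁ = γ := by
      rw [← Real.rpow_add hγ, add_comm, hw, Real.rpow_one]
    rw [Real.rpow_neg hγ.le]
    field_simp
    linarith [hγsplit]
  calc N ≤ ν * D + ν ^ (-γ) * B' := by linarith [key]
    _ = (γ ^ w₂ + γ ^ (-w₁)) * (D ^ w₁ * B' ^ w₂) := by rw [hνD, hνγ]; ring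
    _ = (1 + γ) * γ ^ (-w₁) * (D ^ w₁ * B' ^ w₂) := by rw [hsum]

/-- **Lemma 0 (ii) (both directions, kernel form).** For `γ > 0`, `D > 0`, `B' > 0`: the family
`N − ν D ≤ ν^{−γ} B'` for all `ν > 0` holds iff `N ≤ c_γ · D^{γ/(1+γ)} · B'^{1/(1+γ)}`,
`c_γ = (1+γ) γ^{−γ/(1+γ)}`. [ours; SIEVELD §0 Lemma 0 (ii)] -/
theorem rate_family_iff_mul_rpow {γ N D B' : ℝ} (hγ : 0 < γ) (hD : 0 < D) (hB' : 0 < B') :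
    (∀ ν : ℝ, 0 < ν → N - ν * D ≤ ν ^ (-γ) * B') ↔
      N ≤ (1 + γ) * γ ^ (-(γ / (1 + γ))) * (D ^ (γ / (1 + γ)) * B' ^ (1 / (1 + γ))) :=
  ⟨mul_rpow_le_of_rate_family hγ hD hB',
    fun hN _ν hν => sub_le_rate_family_of_mul_rpow hγ hν hD.le hB'.le hN⟩

/-- **The degenerate case `D = 0` of Lemma 0 (ii): a field with no dissipation rate and positive
production kills the family for EVERY `κ`.** If `γ > 0` and `N ≤ ν^{−γ} B'` for every `ν > 0`, then
`N ≤ 0` (let `ν → ∞`). This is the content of the pen note's proviso P-C: such fields are invisible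
to a supremum taken over `D > 0`. [ours; SIEVELD §0 Lemma 0 (ii), `D₀ = 0` clause] -/
theorem nonpos_of_rate_family_zero {γ N B' : ℝ} (hγ : 0 < γ)
    (h : ∀ ν : ℝ, 0 < ν → N ≤ ν ^ (-γ) * B') : N ≤ 0 := by
  refine le_of_not_gt fun hN => ?_
  have ht : Filter.Tendsto (fun ν : ℝ => ν ^ (-γ) * B') Filter.atTop (nhds (0 * B')) :=
    (tendsto_rpow_neg_atTop hγ).mul_const B'
  rw [zero_mul] at ht
  have hev : ∀ᶠ ν in Filter.atTop, ν ^ (-γ) * B' < N := ht.eventually (gt_mem_nhds hN)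
  obtain ⟨ν, hνlt, hνpos⟩ := (hev.and (Filter.eventually_gt_atTop 0)).exists
  exact (not_le.mpr hνlt) (h ν hνpos)

/-- **The all-fields multiplicative criterion (C4) gives the static rate bound of `T_LD_κ(F; σ, γ)`.**
If `κ ≥ 0`, `F ≥ 0`, `γ > 0`, and at every smooth divergence-free zero-mean datum `D₀ u₀ ≥ 0` and
`N u₀ ≤ c_γ · (D₀ u₀)^{γ/(1+γ)} · (κ (2ℰ u₀) (F u₀)^{1+1/σ})^{1/(1+γ)}`, then
`N u₀ − ν D₀ u₀ ≤ κ ν^{−γ} (2ℰ u₀) (F u₀)^{1+1/σ}` at every such datum and every `ν > 0` — the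
static rate bound with viscous rate `V = −D₀`. [ours; SIEVELD §0 Lemma 0 (ii) + §3 Theorem G's
`κ ≥ C / c_γ^{1+γ}` bookkeeping] -/
theorem staticRateBound_of_mul_rpow {F N D₀ : (UnitAddTorus d → EuclideanSpace ℝ d) → ℝ}
    {σ γ κ : ℝ} (hγ : 0 < γ) (hκ : 0 ≤ κ) (hF : ∀ v, 0 ≤ F v)
    (h : ∀ ⦃u₀ : UnitAddTorus d → EuclideanSpace ℝ d⦄, Torus.IsSmooth u₀ → Torus.IsDivFree u₀ →
      Torus.HasZeroMean u₀ → 0 ≤ D₀ u₀ ∧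
        N u₀ ≤ (1 + γ) * γ ^ (-(γ / (1 + γ))) * (D₀ u₀ ^ (γ / (1 + γ)) *
          (κ * (2 * torusEnstrophy u₀) * F u₀ ^ (1 + σ⁻¹)) ^ (1 / (1 + γ)))) :
    StaticRateBound N (fun v => -D₀ v)
      (fun ν v => κ * ν ^ (-γ) * (2 * torusEnstrophy v) * F v ^ (1 + σ⁻¹)) := by
  intro ν hν u₀ hu₀ hdiv hmean
  obtain ⟨hD, hN⟩ := h hu₀ hdiv hmean
  have hB' : 0 ≤ κ * (2 * torusEnstrophy u₀) * F u₀ ^ (1 + σ⁻¹) :=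
    mul_nonneg (mul_nonneg hκ (by linarith [torusEnstrophy_nonneg u₀])) (Real.rpow_nonneg (hF u₀) _)
  have hfam := sub_le_rate_family_of_mul_rpow hγ hν hD hB' hN
  show N u₀ + ν * -D₀ u₀ ≤ κ * ν ^ (-γ) * (2 * torusEnstrophy u₀) * F u₀ ^ (1 + σ⁻¹)
  calc N u₀ + ν * -D₀ u₀ = N u₀ - ν * D₀ u₀ := by ring
    _ ≤ ν ^ (-γ) * (κ * (2 * torusEnstrophy u₀) * F u₀ ^ (1 + σ⁻¹)) := hfam
    _ = κ * ν ^ (-γ) * (2 * torusEnstrophy u₀) * F u₀ ^ (1 + σ⁻¹) := by ring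

/-- **SIEVELD Lemma 0 + Theorem G bookkeeping, kernel form: the multiplicative criterion (C4) at
every datum, for a functional with rates `(N, −D₀)` at every time, IS the saturating law.** If
`γ > 0`, `κ ≥ 0`, `F ≥ 0`, `F` has inertial rate `N` and viscous rate `−D₀` at every time, and at
every smooth divergence-free zero-mean datum `D₀ ≥ 0` and
`N ≤ c_γ D₀^{γ/(1+γ)} (κ (2ℰ) F^{1+1/σ})^{1/(1+γ)}`, then `SaturatingLaw F σ γ κ`. This is the
generic form of the step every HOLDS row of the cell's `T_LD` table performs. Search for candidate
a priori estimates; no regularity claim. [ours; SIEVELD §0 Lemma 0, §3 Theorem G] -/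
theorem saturatingLaw_of_mul_rpow {F N D₀ : (UnitAddTorus d → EuclideanSpace ℝ d) → ℝ}
    {σ γ κ : ℝ} (hγ : 0 < γ) (hκ : 0 ≤ κ) (hF : ∀ v, 0 ≤ F v)
    (hNV : HasRateEverywhere F N (fun v => -D₀ v))
    (h : ∀ ⦃u₀ : UnitAddTorus d → EuclideanSpace ℝ d⦄, Torus.IsSmooth u₀ → Torus.IsDivFree u₀ →
      Torus.HasZeroMean u₀ → 0 ≤ D₀ u₀ ∧
        N u₀ ≤ (1 + γ) * γ ^ (-(γ / (1 + γ))) * (D₀ u₀ ^ (γ / (1 + γ)) *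
          (κ * (2 * torusEnstrophy u₀) * F u₀ ^ (1 + σ⁻¹)) ^ (1 / (1 + γ)))) :
    SaturatingLaw (d := d) F σ γ κ :=
  saturatingLaw_of_staticRateBound hNV (staticRateBound_of_mul_rpow hγ hκ hF h)

end Summit.NavierStokesRegularity.FunctionalMining
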